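import Literature.NumberTheory.EllipticCurves.BinaryQuarticTwoCoveringsCocycle
import HarnessLib

/-!
# Two-coverings attached to binary quartic forms, IV: `K`-equivalent forms have the same class

Topic `Literature/NumberTheory/EllipticCurves`. Fourth file of the theory proving the named fact
`Literature.NumberTheory.EllipticCurves.bhargavaShankar_card_selmerTwo_eq_kEquivClassCount`
(`BinaryQuarticMinimisation.lean`; Bhargava–Shankar 2015, held arXiv text §5.1, Lemma 5.2).

If `g' = μ²(γ · g)` (`KEquiv`, the substitution action `(γ · g)(x, y) = g((x, y)γ)`), the roots of
`g'(x, 1)` are the Möbius images `m(rᵢ) = (rᵢγ₁₁ − γ₁₀)/(γ₀₀ − rᵢγ₀₁)` of the roots of `g(x, 1)`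
(`smul_subst_ofRootVec`), the resolvent values transform as `φ_{g'}(m u, m v) = μ²(det γ)²φ_g(u, v)`
(`phi_smul_subst`), hence with `t'² = μ²(det γ)²t²` the torsor differences agree,
`T_{g'}(m u, m v) = T_g(u, v)` (`torsorPt_smul_subst`), and so do the cocycles:
`T_{g'}(m r₀, σ m r₀) = T_g(r₀, σ r₀)` (`cocycleFun_kEquiv`). Over `ℚ` the relation
`t'² = μ²(det γ)²t²` is automatic for two forms in the `E_{A,B}`-family (`sq_t_eq_of_kEquiv`: from
`t'⁴ = s⁴` if `A ≠ 0`, `t'⁶ = s⁶` if `B ≠ 0`, squares being positive), whence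
**`ℚ`-equivalent forms have the same Selmer class** (`selmerClass_eq_of_kEquiv`) — the direction
"`g ∼ g*` ⇒ same `2`-covering" of Cremona 2001, Prop. 3.2 (2) / Remark after Prop. 4.3
("equivalence of `2`-coverings … corresponds exactly to replacing the quartic `g` defining `C` with
an equivalent quartic"), i.e. the well-definedness of Bhargava–Shankar's correspondence
(Lemma 5.2) on equivalence classes.

## References

* J. E. Cremona, *Classical invariants and 2-descent on elliptic curves*, J. Symbolic Comput. 31
  (2001) 71–87, Prop. 3.2 and the Remark after Prop. 4.3. [Cremona2001]
* M. Bhargava, A. Shankar, Ann. of Math. (2) 181 (2015), §5.1 of arXiv:1006.1002v2, Lemma 5.2.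
  [BhargavaShankarAnnals2015]
-/

noncomputable section

open scoped Classical

universe u

namespace Literature.NumberTheory.EllipticCurves

namespace BinaryQuartic

/-! ## §1 Roots of a transformed form -/

section SubstRoots

variable {F S : Type*} [Field F] [Field S]

/-- The Möbius image of a root under the substitution `γ`: if `g(r, 1) = 0` then
`(γ · g)(m, 1) = 0` for `m = (rγ₁₁ − γ₁₀)/(γ₀₀ − rγ₀₁)` (when `γ₀₀ ≠ rγ₀₁`). [folklore] -/
def substRoot (γ : Matrix (Fin 2) (Fin 2) F) (r : F) : F :=
  (r * γ 1 1 - γ 1 0) / (γ 0 0 - r * γ 0 1)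

/-- `substRoot` commutes with field homomorphisms. [folklore] -/
theorem substRoot_map (ψ : F →+* S) (γ : Matrix (Fin 2) (Fin 2) F) (r : F) :
    substRoot (γ.map ψ) (ψ r) = ψ (substRoot γ r) := by
  simp [substRoot, Matrix.map_apply]

/-- The Möbius map of an invertible matrix is injective (where defined). [folklore] -/
theorem substRoot_injective {γ : Matrix (Fin 2) (Fin 2) F} (hγ : γ.det ≠ 0) {u v : F}
    (hu : γ 0 0 - u * γ 0 1 ≠ 0) (hv : γ 0 0 - v * γ 0 1 ≠ 0)
    (h : substRoot γ u = substRoot γ v) : u = v := by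
  rw [substRoot, substRoot, div_eq_div_iff hu hv] at h
  rw [Matrix.det_fin_two] at hγ
  have key : (u - v) * (γ 0 0 * γ 1 1 - γ 0 1 * γ 1 0) = 0 := by linear_combination h
  rcases mul_eq_zero.mp key with h1 | h1
  · exact sub_eq_zero.mp h1
  · exact absurd h1 hγ

/-- **Roots of a transformed form.** `μ²(γ · a∏ᵢ(x − rᵢy)) = a' ∏ᵢ (x − m(rᵢ)y)` with
`a' = μ²a∏ᵢ(γ₀₀ − rᵢγ₀₁)` and `m` the Möbius map of `γ` (`substRoot`), provided no root goes to
infinity (`γ₀₀ ≠ rᵢγ₀₁`). [folklore] -/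
theorem smul_subst_ofRootVec (μ a : F) (r : Fin 4 → F) (γ : Matrix (Fin 2) (Fin 2) F)
    (h : ∀ i, γ 0 0 - r i * γ 0 1 ≠ 0) :
    μ ^ 2 • (ofRootVec a r).subst γ =
      ofRootVec (μ ^ 2 * a * ((γ 0 0 - r 0 * γ 0 1) * (γ 0 0 - r 1 * γ 0 1) *
        (γ 0 0 - r 2 * γ 0 1) * (γ 0 0 - r 3 * γ 0 1))) (fun i ↦ substRoot γ (r i)) := by
  have h0 := h 0; have h1 := h 1; have h2 := h 2; have h3 := h 3
  ext <;> simp only [smul_a, smul_b, smul_c, smul_d, smul_e, subst, ofRootVec, ofRoots, substRoot] <;>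
    field_simp <;> ring

/-- The leading coefficient of `γ · g` is `g(γ₀₀, γ₀₁)` (local copy of the tree's
`BinaryQuartic.a_subst_eq_eval` of `BhargavaShankarSolubleOrbits.lean`, not imported here). [folklore] -/
theorem a_subst_eq_eval (g : BinaryQuartic F) (γ : Matrix (Fin 2) (Fin 2) F) :
    (g.subst γ).a = g.eval (γ 0 0) (γ 0 1) := by
  simp only [subst, BinaryQuartic.eval]

variable {g : BinaryQuartic F} (R : RootData g) {μ : F} {γ : Matrix (Fin 2) (Fin 2) F}

/-- If `μ²(γ · g)` has nonzero leading coefficient then no root of `g` is sent to infinity: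
`γ₀₀ ≠ rᵢγ₀₁`. [folklore] -/
theorem RootData.sub_mul_ne_zero (ha' : (μ ^ 2 • g.subst γ).a ≠ 0) (i : Fin 4) :
    γ 0 0 - R.r i * γ 0 1 ≠ 0 := by
  rw [smul_a, a_subst_eq_eval, R.eval_eq] at ha'
  obtain ⟨h012, h3⟩ := mul_ne_zero_iff.mp (mul_ne_zero_iff.mp ha').2
  obtain ⟨h01, h2⟩ := mul_ne_zero_iff.mp h012
  obtain ⟨h0, h1⟩ := mul_ne_zero_iff.mp h01
  obtain ⟨-, h0⟩ := mul_ne_zero_iff.mp h0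
  fin_cases i
  · exact h0
  · exact h1
  · exact h2
  · exact h3

/-- **Root data of a transformed form**: the roots of `μ²(γ · g)` are the Möbius images of the
roots of `g`. [folklore] -/
def RootData.smulSubst (ha' : (μ ^ 2 • g.subst γ).a ≠ 0) : RootData (μ ^ 2 • g.subst γ) where
  r := fun i ↦ substRoot γ (R.r i)
  eq_ofRoots := by
    have hne := R.sub_mul_ne_zero ha'
    have key := smul_subst_ofRootVec μ g.a R.r γ hne
    rw [← R.eq_ofRoots] at key
    have ha : (μ ^ 2 • g.subst γ).a = μ ^ 2 * g.a * ((γ 0 0 - R.r 0 * γ 0 1) *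
        (γ 0 0 - R.r 1 * γ 0 1) * (γ 0 0 - R.r 2 * γ 0 1) * (γ 0 0 - R.r 3 * γ 0 1)) := by
      rw [key]
      exact rfl
    rw [ha]
    exact key

/-- The roots of the transformed data (definitional). [folklore] -/
@[simp] theorem RootData.smulSubst_r (ha' : (μ ^ 2 • g.subst γ).a ≠ 0) (i : Fin 4) :
    (R.smulSubst ha').r i = substRoot γ (R.r i) := rfl

/-- `φ(r₀, r₁) = a((r₀ − r₂)(r₁ − r₃) + (r₀ − r₃)(r₁ − r₂))` — an "irrational seminvariant": a
function of the root differences (Cremona 2001, §3, before Prop. 3.1). [cite: Cremona2001, §3 (irrational seminvariants)] -/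
theorem phi_ofRootVec_eq_diff (a : F) (r : Fin 4 → F) :
    phi (ofRootVec a r) (r 0) (r 1) = a * ((r 0 - r 2) * (r 1 - r 3) + (r 0 - r 3) * (r 1 - r 2)) := by
  simp only [phi, ofRootVec, ofRoots]; ring

/-- Differences of Möbius images: `m(u) − m(v) = det(γ)(u − v)/((γ₀₀ − uγ₀₁)(γ₀₀ − vγ₀₁))`. [folklore] -/
theorem substRoot_sub (γ : Matrix (Fin 2) (Fin 2) F) {u v : F} (hu : γ 0 0 - u * γ 0 1 ≠ 0)
    (hv : γ 0 0 - v * γ 0 1 ≠ 0) :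
    substRoot γ u - substRoot γ v = γ.det * (u - v) / ((γ 0 0 - u * γ 0 1) * (γ 0 0 - v * γ 0 1)) := by
  rw [substRoot, substRoot, Matrix.det_fin_two, div_sub_div _ _ hu hv,
    div_eq_div_iff (mul_ne_zero hu hv) (mul_ne_zero hu hv)]
  ring

/-- **Transformation of the resolvent values**: `φ_{μ²(γ·g)}(m r₀, m r₁) = μ²(det γ)² φ_g(r₀, r₁)`
for `ofRootVec` (Cremona 2001, proof of Prop. 3.2 (2): the cubic seminvariant `z` scales by
squares under the generators of `GL(2, K)`; here via `φ = a((r₀−r₂)(r₁−r₃) + (r₀−r₃)(r₁−r₂))` and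
`m(u) − m(v) = det(γ)(u − v)/((γ₀₀ − uγ₀₁)(γ₀₀ − vγ₀₁))`). [cite: Cremona2001, proof of Prop. 3.2 (2)] -/
theorem phi_smul_subst_ofRootVec (μ a : F) (r : Fin 4 → F) (γ : Matrix (Fin 2) (Fin 2) F)
    (h : ∀ i, γ 0 0 - r i * γ 0 1 ≠ 0) :
    phi (μ ^ 2 • (ofRootVec a r).subst γ) (substRoot γ (r 0)) (substRoot γ (r 1)) =
      μ ^ 2 * γ.det ^ 2 * phi (ofRootVec a r) (r 0) (r 1) := by
  have h0 := h 0; have h1 := h 1; have h2 := h 2; have h3 := h 3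
  rw [smul_subst_ofRootVec μ a r γ h,
    phi_ofRootVec_eq_diff _ (fun i ↦ substRoot γ (r i)), phi_ofRootVec_eq_diff,
    substRoot_sub γ h0 h2, substRoot_sub γ h1 h3, substRoot_sub γ h0 h3, substRoot_sub γ h1 h2,
    div_mul_div_comm, div_mul_div_comm, div_add_div _ _ (mul_ne_zero (mul_ne_zero h0 h2)
      (mul_ne_zero h1 h3)) (mul_ne_zero (mul_ne_zero h0 h3) (mul_ne_zero h1 h2)), mul_div_assoc',
    div_eq_iff (mul_ne_zero (mul_ne_zero (mul_ne_zero h0 h2) (mul_ne_zero h1 h3))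
      (mul_ne_zero (mul_ne_zero h0 h3) (mul_ne_zero h1 h2)))]
  ring

/-- **Transformation of the resolvent values** for two distinct roots:
`φ_{μ²(γ·g)}(m rᵢ, m rⱼ) = μ²(det γ)² φ_g(rᵢ, rⱼ)`. [cite: Cremona2001, proof of Prop. 3.2 (2)] -/
theorem RootData.phi_smul_subst (ha' : (μ ^ 2 • g.subst γ).a ≠ 0) {i j : Fin 4} (hij : i ≠ j) :
    phi (μ ^ 2 • g.subst γ) (substRoot γ (R.r i)) (substRoot γ (R.r j)) =
      μ ^ 2 * γ.det ^ 2 * phi g (R.r i) (R.r j) := by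
  obtain ⟨k, hki, hkj⟩ : ∃ k : Fin 4, k ≠ i ∧ k ≠ j := by revert i j; decide
  obtain ⟨σ, h0, h1, -⟩ := exists_perm_fin_four hij hkj.symm hki.symm
  have hne := (R.reindex σ).sub_mul_ne_zero ha'
  have key := phi_smul_subst_ofRootVec μ g.a (R.reindex σ).r γ hne
  rw [← (R.reindex σ).eq_ofRoots] at key
  simpa [h0, h1] using key

/-- **The torsion abscissae are invariant**: with `t'² = μ²(det γ)²t²`,
`x_{μ²(γ·g), t'}(m rᵢ, m rⱼ) = x_{g, t}(rᵢ, rⱼ)`. [folklore] -/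
theorem RootData.torsX_smul_subst (ha' : (μ ^ 2 • g.subst γ).a ≠ 0) (h3 : (3 : F) ≠ 0) {t t' : F}
    (ht : t ≠ 0) (hμ : μ ≠ 0) (hγ : γ.det ≠ 0) (htt : t' ^ 2 = μ ^ 2 * γ.det ^ 2 * t ^ 2)
    {i j : Fin 4} (hij : i ≠ j) :
    torsX (μ ^ 2 • g.subst γ) t' (substRoot γ (R.r i)) (substRoot γ (R.r j)) =
      torsX g t (R.r i) (R.r j) := by
  rw [torsX, torsX, R.phi_smul_subst ha' hij, htt]
  field_simp

end SubstRoots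

end BinaryQuartic

namespace TwoCovering

open BinaryQuartic WeierstrassCurve WeierstrassCurve.Affine GaloisRepresentations

/-! ## §2 Equivalent forms give the same torsor and the same cocycle -/

section Torsor

variable {F : Type*} [Field F] {C : Affine F}
variable {g : BinaryQuartic F} (R : RootData g) {μ : F} {γ : Matrix (Fin 2) (Fin 2) F}

/-- **Equivalent forms have the same torsor**: `T_{μ²(γ·g), t'}(m rᵢ, m rⱼ) = T_{g, t}(rᵢ, rⱼ)` when
`t'² = μ²(det γ)²t²` (Cremona 2001, Remark after Prop. 4.3: replacing `g` by an equivalent quartic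
gives an equivalent `2`-covering). [cite: Cremona2001, Remark after Prop. 4.3 (equivalent quartics give equivalent 2-coverings)] -/
theorem torsorPt_smul_subst (ha' : (μ ^ 2 • g.subst γ).a ≠ 0) (h3 : (3 : F) ≠ 0) {t t' : F}
    (ht : t ≠ 0) (hμ : μ ≠ 0) (hγ : γ.det ≠ 0) (htt : t' ^ 2 = μ ^ 2 * γ.det ^ 2 * t ^ 2)
    (i j : Fin 4) :
    torsorPt C (μ ^ 2 • g.subst γ) t' (substRoot γ (R.r i)) (substRoot γ (R.r j)) =
      torsorPt C g t (R.r i) (R.r j) := by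
  by_cases hij : i = j
  · subst hij; rw [torsorPt_self, torsorPt_self]
  have hne := R.sub_mul_ne_zero ha'
  have hx := R.torsX_smul_subst ha' h3 ht hμ hγ htt hij
  have hiff : substRoot γ (R.r i) ≠ substRoot γ (R.r j) ↔ R.r i ≠ R.r j :=
    not_congr ⟨substRoot_injective hγ (hne i) (hne j), fun h ↦ by rw [h]⟩
  by_cases h : substRoot γ (R.r i) ≠ substRoot γ (R.r j) ∧
      C.Nonsingular (torsX (μ ^ 2 • g.subst γ) t' (substRoot γ (R.r i)) (substRoot γ (R.r j))) 0
  · have h' : R.r i ≠ R.r j ∧ C.Nonsingular (torsX g t (R.r i) (R.r j)) 0 :=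
      ⟨hiff.mp h.1, hx ▸ h.2⟩
    rw [torsorPt, dif_pos h, torsorPt, dif_pos h']
    simp only [Point.some.injEq, and_true]
    exact hx
  · have h' : ¬(R.r i ≠ R.r j ∧ C.Nonsingular (torsX g t (R.r i) (R.r j)) 0) := fun h' ↦
      h ⟨hiff.mpr h'.1, hx.symm ▸ h'.2⟩
    rw [torsorPt, dif_neg h, torsorPt, dif_neg h']

end Torsor

section Cocycle

variable {R₀ K Ω : Type*} [CommRing R₀] [Field K] [Field Ω] [Algebra R₀ Ω] [Algebra K Ω]
variable (W : WeierstrassCurve R₀) {g : BinaryQuartic K} {μ t t' : K} {γ : Matrix (Fin 2) (Fin 2) K}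
  {r₀ : Ω}

omit [Algebra K Ω] in
/-- Base change of a transformed form: `(μ²(γ·g)) ⊗ Ω = μ²(γ · (g ⊗ Ω))`. [folklore] -/
theorem map_smul_subst (ψ : K →+* Ω) (μ : K) (g : BinaryQuartic K) (γ : Matrix (Fin 2) (Fin 2) K) :
    (μ ^ 2 • g.subst γ).map ψ = ψ μ ^ 2 • (g.map ψ).subst (γ.map ψ) := by
  ext <;> simp [BinaryQuartic.map, subst, Matrix.map_apply, map_ofNat]

/-- **Equivalent forms have the same cocycle.** For `g' = μ²(γ · g)` over `K` with `a(g') ≠ 0` and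
`t'² = μ²(det γ)²t²`, the cocycle of `g'` at the root `m(r₀)` equals the cocycle of `g` at `r₀`:
`T_{g'}(m r₀, σ m r₀) = T_g(r₀, σ r₀)` for all `σ ∈ Gal(Ω/K)` (the Möbius map `m` has coefficients
in `K`, so `σ m r₀ = m σ r₀`). Cremona 2001, Remark after Prop. 4.3. [cite: Cremona2001, Remark after Prop. 4.3 (equivalent quartics give equivalent 2-coverings)] -/
theorem cocycleFun_kEquiv (R : RootData (g.map (algebraMap K Ω))) (ha : g.a ≠ 0)
    (ha' : (μ ^ 2 • g.subst γ).a ≠ 0) (h3 : (3 : Ω) ≠ 0) (ht : t ≠ 0) (hμ : μ ≠ 0) (hγ : γ.det ≠ 0)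
    (htt : t' ^ 2 = μ ^ 2 * γ.det ^ 2 * t ^ 2) (hr₀ : (g.map (algebraMap K Ω)).eval r₀ 1 = 0)
    (σ : Ω ≃ₐ[K] Ω) :
    cocycleFun W (μ ^ 2 • g.subst γ) t' (substRoot (γ.map (algebraMap K Ω)) r₀) σ =
      cocycleFun W g t r₀ σ := by
  set ψ := algebraMap K Ω
  have haΩ' : (ψ μ ^ 2 • (g.map ψ).subst (γ.map ψ)).a ≠ 0 := by
    rw [← map_smul_subst]; simpa using ha'
  have hγΩ : (γ.map ψ).det ≠ 0 := by
    rw [← RingHom.mapMatrix_apply, ← RingHom.map_det]; exact (map_ne_zero ψ).mpr hγ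
  have httΩ : ψ t' ^ 2 = ψ μ ^ 2 * (γ.map ψ).det ^ 2 * ψ t ^ 2 := by
    rw [← RingHom.mapMatrix_apply, ← RingHom.map_det, ← map_pow, htt]; simp
  obtain ⟨i, hi⟩ := exists_eq_r R ha hr₀
  obtain ⟨j, hj⟩ := exists_eq_r R ha (eval_apply_eq_zero σ hr₀)
  have hσm : σ (substRoot (γ.map ψ) r₀) = substRoot (γ.map ψ) (σ r₀) := by
    have h := substRoot_map (σ : Ω →+* Ω) (γ.map ψ) r₀
    have hγσ : (γ.map ψ).map (σ : Ω →+* Ω) = γ.map ψ := by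
      ext a b; simp [Matrix.map_apply, ψ]
    rw [hγσ] at h
    exact h.symm
  rw [cocycleFun_apply, cocycleFun_apply, hσm, map_smul_subst, hj, hi]
  exact torsorPt_smul_subst R haΩ' h3 ((map_ne_zero ψ).mpr ht) ((map_ne_zero ψ).mpr hμ) hγΩ httΩ
    i j

/-- The Möbius image of a root of `g` is a root of `μ²(γ · g)` (over `Ω`). [folklore] -/
theorem eval_substRoot_eq_zero (R : RootData (g.map (algebraMap K Ω))) (ha : g.a ≠ 0)
    (ha' : (μ ^ 2 • g.subst γ).a ≠ 0) (hr₀ : (g.map (algebraMap K Ω)).eval r₀ 1 = 0) :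
    ((μ ^ 2 • g.subst γ).map (algebraMap K Ω)).eval
      (substRoot (γ.map (algebraMap K Ω)) r₀) 1 = 0 := by
  set ψ := algebraMap K Ω
  have haΩ' : (ψ μ ^ 2 • (g.map ψ).subst (γ.map ψ)).a ≠ 0 := by
    rw [← map_smul_subst]; simpa using ha'
  obtain ⟨i, hi⟩ := exists_eq_r R ha hr₀
  rw [map_smul_subst, hi]
  exact (R.smulSubst haΩ').eval_r i

end Cocycle

/-! ## §3 Over `ℚ`: equivalent forms in the `E_{A,B}`-family have the same Selmer class -/

section Rat

variable {AB : ℤ × ℤ} {g g' : BinaryQuartic ℚ} {t t' : ℚ}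

/-- Over `ℚ`, `t'² = s²` follows from `t'⁴ = s⁴` (both sides are squares of nonzero rationals, hence
positive). [folklore] -/
theorem sq_eq_sq_of_pow_four_eq {a b : ℚ} (h : a ^ 4 = b ^ 4) : a ^ 2 = b ^ 2 := by
  have h' : (a ^ 2) ^ 2 = (b ^ 2) ^ 2 := by rw [← pow_mul, ← pow_mul]; exact h
  exact (sq_eq_sq₀ (sq_nonneg a) (sq_nonneg b)).mp h'

/-- Over `ℚ`, `t'² = s²` follows from `t'⁶ = s⁶` (cubing is injective). [folklore] -/
theorem sq_eq_sq_of_pow_six_eq {a b : ℚ} (h : a ^ 6 = b ^ 6) : a ^ 2 = b ^ 2 := by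
  have h' : (a ^ 2) ^ 3 = (b ^ 2) ^ 3 := by rw [← pow_mul, ← pow_mul]; exact h
  exact (Odd.strictMono_pow (by decide : Odd 3)).injective h'

/-- **The scalars of two equivalent forms in the `E_{A,B}`-family**: if `g' = μ²(γ · g)` and
`I(g) = −3At⁴`, `J(g) = −27Bt⁶`, `I(g') = −3At'⁴`, `J(g') = −27Bt'⁶` with `4A³ + 27B² ≠ 0`, then
`t'² = μ²(det γ)²t²` (from `I(γ·g) = (det γ)⁴I(g)`, `J(γ·g) = (det γ)⁶J(g)`: `t'⁴ = s⁴` if `A ≠ 0`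
and `t'⁶ = s⁶` if `B ≠ 0`, `s = μ det(γ) t`). Compare Bhargava–Shankar, proof of Thm 5.6 ("two
integral binary quartic forms having the same invariants are equivalent iff `PGL₂(ℚ)`-equivalent").
[cite: BhargavaShankarAnnals2015, proof of Thm 5.6 (arXiv:1006.1002v2 numbering)] -/
theorem sq_t_eq_of_kEquiv (h : Setup g (AB.1 : ℚ) (AB.2 : ℚ) t) (h' : Setup g' (AB.1 : ℚ) (AB.2 : ℚ) t')
    {μ : ℚ} {γ : Matrix (Fin 2) (Fin 2) ℚ} (hg' : g' = μ ^ 2 • g.subst γ) :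
    t' ^ 2 = μ ^ 2 * γ.det ^ 2 * t ^ 2 := by
  have hI : g'.I = (μ * γ.det) ^ 4 * g.I := by rw [hg', I_smul, I_subst]; ring
  have hJ : g'.J = (μ * γ.det) ^ 6 * g.J := by rw [hg', J_smul, J_subst]; ring
  rw [h.I_eq, h'.I_eq] at hI
  rw [h.J_eq, h'.J_eq] at hJ
  have hA : (AB.1 : ℚ) * (t' ^ 4 - (μ * γ.det * t) ^ 4) = 0 := by linear_combination (-1 / 3 : ℚ) * hI
  have hB : (AB.2 : ℚ) * (t' ^ 6 - (μ * γ.det * t) ^ 6) = 0 := by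
    linear_combination (-1 / 27 : ℚ) * hJ
  have key : t' ^ 2 = (μ * γ.det * t) ^ 2 := by
    by_cases hA0 : (AB.1 : ℚ) = 0
    · have hB0 : (AB.2 : ℚ) ≠ 0 := by
        intro hB0; apply h.disc_ne; rw [hA0, hB0]; ring
      exact sq_eq_sq_of_pow_six_eq (sub_eq_zero.mp ((mul_eq_zero.mp hB).resolve_left hB0))
    · exact sq_eq_sq_of_pow_four_eq (sub_eq_zero.mp ((mul_eq_zero.mp hA).resolve_left hA0))
  rw [key]; ring

/-- **`ℚ`-equivalent forms have the same Selmer class.** If `g' = μ²(γ · g)` with `g`, `g'` in the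
`E_{A,B}`-family (leading coefficients nonzero), then `selmerClass g' = selmerClass g` in
`H¹(ℚ, E_{A,B}[2])`, for any choices of roots (Cremona 2001, Prop. 3.2 (2) "⇒" / Remark after
Prop. 4.3; the well-definedness of Bhargava–Shankar's correspondence, Lemma 5.2, on equivalence
classes). [cite: Cremona2001, Prop. 3.2 (2) and Remark after Prop. 4.3] -/
theorem selmerClass_eq_of_kEquiv (h : Setup g (AB.1 : ℚ) (AB.2 : ℚ) t)
    (h' : Setup g' (AB.1 : ℚ) (AB.2 : ℚ) t') {μ : ℚ} (hμ : μ ≠ 0) {γ : Matrix (Fin 2) (Fin 2) ℚ}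
    (hγ : γ.det ≠ 0) (hg' : g' = μ ^ 2 • g.subst γ) {r₀ s₀ : AlgebraicClosure ℚ}
    (hr₀ : (g.map (algebraMap ℚ (AlgebraicClosure ℚ))).eval r₀ 1 = 0)
    (hs₀ : (g'.map (algebraMap ℚ (AlgebraicClosure ℚ))).eval s₀ 1 = 0) :
    selmerClass h' hs₀ = selmerClass h hr₀ := by
  subst hg'
  obtain ⟨R⟩ := RootData.nonempty (f := g.map (algebraMap ℚ (AlgebraicClosure ℚ)))
    (by simpa using h.a_ne)
  have htt := sq_t_eq_of_kEquiv h h' rfl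
  -- move the root of `g'` to the Möbius image of `r₀`
  have hm : ((μ ^ 2 • g.subst γ).map (algebraMap ℚ (AlgebraicClosure ℚ))).eval
      (substRoot (γ.map (algebraMap ℚ (AlgebraicClosure ℚ))) r₀) 1 = 0 :=
    eval_substRoot_eq_zero R h.a_ne h'.a_ne hr₀
  rw [selmerClass_changeRoot h' hm hs₀, selmerClass, selmerClass]
  congr 1
  apply Subtype.ext
  apply ContinuousMap.ext
  intro σ
  apply Subtype.ext
  change geomCocycleFun AB (μ ^ 2 • g.subst γ) t' _ σ = geomCocycleFun AB g t r₀ σ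
  rw [geomCocycleFun_eq, geomCocycleFun_eq]
  exact cocycleFun_kEquiv (shortWeierstrass AB) R h.a_ne h'.a_ne (by norm_num) h.t_ne hμ hγ htt hr₀ _

end Rat

end TwoCovering

end Literature.NumberTheory.EllipticCurves
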